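import Mathlib
import HarnessLib
import Literature.MathematicalPhysics.QuantumLattice.HubbardUVGridPieceMoment

/-!
# The space-moment constant of a piece is LINEAR in the piece amplitudes: `√(Σ) ≤ Σ√`, monotonicity, and the linearised form
# `uvSpaceMomentConst Λ R (uvPieceSq Λ Q Q′) ≤ ¼√(216(1/Λ+½))·R·Σ_{(e₁,e₂)} (1/(4R))^{e₁+e₂}·(V_k·Q_k + D_k·Q′_k)`, `k = 1 + e₁ + e₂`

Topic `MathematicalPhysics/QuantumLattice`; continues `HubbardUVGridPieceMoment`.  The telescoped first space moment of the scale-`0`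
covariance of a framed band (Benfatto–Giuliani–Mastropietro 2006, §3 (3.2)–(3.8)) is a SUM over frame pieces of per-piece constants
`uvSpaceMomentConst Λ Rₘ (uvPieceSq Λ Qₘ Q′ₘ)`; to sum the geometric series in the piece index one needs these constants bounded
LINEARLY by the amplitudes `Qₘ(k)`, `Q′ₘ(k)` with the scale `Rₘ` entering as `Rₘ·(1/(4Rₘ))^{k-1}` — which is what this file records.

* `sqrt_sum_le_sum_sqrt` — subadditivity of the square root;
* `uvPieceSq_mono`, `uvSpaceMomentConst_mono` — monotonicity in the amplitudes / in the table;
* `uvLinV`, `uvLinD`, **`uvSpaceMomentConst_le_linear`** — the linearised bound.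

Everything is proved; `uvLinV`, `uvLinD` are the only definitions; no named facts.

## Sources

G. Benfatto, A. Giuliani, V. Mastropietro, Ann. Henri Poincaré 7 (2006) 809–898, §2.8 (2.80)–(2.81), §3 (3.2)–(3.8)
(`BenfattoGiulianiMastropietro2006`).
-/

noncomputable section

namespace Literature.MathematicalPhysics.QuantumLattice

open Finset

/-! ### §1 Square roots of sums -/

/-- `√(Σᵢ fᵢ) ≤ Σᵢ √fᵢ` (`fᵢ ≥ 0`). [cite: BenfattoGiulianiMastropietro2006, §2.8 (2.81)] -/
theorem sqrt_sum_le_sum_sqrt {ι : Type*} (s : Finset ι) (f : ι → ℝ) (hf : ∀ i ∈ s, 0 ≤ f i) :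
    Real.sqrt (∑ i ∈ s, f i) ≤ ∑ i ∈ s, Real.sqrt (f i) := by
  classical
  -- two terms (`MatomakiRadziwillTaoMajorArc.sqrt_add_le_sqrt_add_sqrt`, re-proved locally to keep the imports light)
  have h2 : ∀ {a b : ℝ}, 0 ≤ a → 0 ≤ b → Real.sqrt (a + b) ≤ Real.sqrt a + Real.sqrt b := fun {a b} ha hb => by
    have h1 : a + b ≤ (Real.sqrt a + Real.sqrt b) ^ 2 := by
      nlinarith [Real.sq_sqrt ha, Real.sq_sqrt hb, Real.sqrt_nonneg a, Real.sqrt_nonneg b]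
    calc Real.sqrt (a + b) ≤ Real.sqrt ((Real.sqrt a + Real.sqrt b) ^ 2) := Real.sqrt_le_sqrt h1
      _ = Real.sqrt a + Real.sqrt b := Real.sqrt_sq (by positivity)
  induction s using Finset.induction_on with
  | empty => simp
  | insert a s has ih =>
    rw [sum_insert has, sum_insert has]
    have hfa : 0 ≤ f a := hf a (mem_insert_self a s)
    have hfs : ∀ i ∈ s, 0 ≤ f i := fun i hi => hf i (mem_insert_of_mem hi)
    exact (h2 hfa (sum_nonneg hfs)).trans (add_le_add le_rfl (ih hfs))

/-! ### §2 Monotonicity -/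

/-- `uvPieceSq` is monotone in the (non-negative) amplitudes. [cite: BenfattoGiulianiMastropietro2006, (2.36aa)] -/
theorem uvPieceSq_mono {Λ : ℝ} (hΛ : 0 < Λ) {Q Q' q q' : ℕ → ℝ} (hQ0 : ∀ k, 0 ≤ Q k) (hQ'0 : ∀ k, 0 ≤ Q' k)
    (hQ : ∀ k, Q k ≤ q k) (hQ' : ∀ k, Q' k ≤ q' k) (t k : ℕ) : uvPieceSq Λ Q Q' t k ≤ uvPieceSq Λ q q' t k := by
  have h1 : Q k ^ 2 ≤ q k ^ 2 := pow_le_pow_left₀ (hQ0 k) (hQ k) 2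
  have h2 : Q' k ^ 2 ≤ q' k ^ 2 := pow_le_pow_left₀ (hQ'0 k) (hQ' k) 2
  unfold uvPieceSq
  split_ifs
  · exact mul_le_mul_of_nonneg_left h1 (by positivity)
  · refine add_le_add ?_ (div_le_div_of_nonneg_right (mul_le_mul_of_nonneg_left h1 (by positivity)) (by positivity))
    exact mul_le_mul_of_nonneg_right (mul_le_mul_of_nonneg_left h2 (by positivity)) (by positivity)

/-- `uvSpaceMomentConst` is monotone in the (non-negative) table. [cite: BenfattoGiulianiMastropietro2006, §2.8 (2.80)] -/
theorem uvSpaceMomentConst_mono {Λ : ℝ} (hΛ : 0 < Λ) (R : ℕ) {Kq Kq' : ℕ → ℕ → ℝ}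
    (h : ∀ t k, Kq t k ≤ Kq' t k) : uvSpaceMomentConst Λ R Kq ≤ uvSpaceMomentConst Λ R Kq' := by
  unfold uvSpaceMomentConst
  refine mul_le_mul_of_nonneg_left (Real.sqrt_le_sqrt (sum_le_sum fun e _ => ?_)) (by positivity)
  exact mul_le_mul_of_nonneg_left (h _ _) (by positivity)

/-! ### §3 The linearised bound -/

/-- Coefficient of the value amplitude `Q_k`: `(2π)ᵏ·(√(8/Λ) + (Λ/4)·√2/π)`. [cite: BenfattoGiulianiMastropietro2006, §2.8 (2.80)] -/
def uvLinV (Λ : ℝ) (k : ℕ) : ℝ := (2 * Real.pi) ^ k * (Real.sqrt (8 / Λ) + Λ / 4 * (Real.sqrt 2 / Real.pi))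

/-- Coefficient of the step amplitude `Q′_k`: `(Λ/4)·(2π)^{k+1}·4·√(2/Λ + 2/Λ²)`. [cite: BenfattoGiulianiMastropietro2006, §2.8 (2.80)] -/
def uvLinD (Λ : ℝ) (k : ℕ) : ℝ := Λ / 4 * ((2 * Real.pi) ^ (k + 1) * 4 * Real.sqrt (2 / Λ + 2 / Λ ^ 2))

/-- `uvLinV ≥ 0`. [cite: BenfattoGiulianiMastropietro2006, §2.8 (2.80)] -/
theorem uvLinV_nonneg {Λ : ℝ} (hΛ : 0 < Λ) (k : ℕ) : 0 ≤ uvLinV Λ k := by unfold uvLinV; positivity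

/-- `uvLinD ≥ 0`. [cite: BenfattoGiulianiMastropietro2006, §2.8 (2.80)] -/
theorem uvLinD_nonneg {Λ : ℝ} (hΛ : 0 < Λ) (k : ℕ) : 0 ≤ uvLinD Λ k := by unfold uvLinD; positivity

/-- **The space-moment constant is linear in the amplitudes**: for `Q, Q′ ≥ 0`,
`uvSpaceMomentConst Λ R (uvPieceSq Λ Q Q′) ≤ ¼·√(216(1/Λ + ½))·R·Σ_{(e₁,e₂) ∈ {0,1}²} (1/(4R))^{e₁+e₂}·(V_k Q_k + D_k Q′_k)`, `k = 1+e₁+e₂`.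
[cite: BenfattoGiulianiMastropietro2006, §2.8 (2.80)–(2.81) and §3 (3.3)] -/
theorem uvSpaceMomentConst_le_linear {Λ : ℝ} (hΛ : 0 < Λ) (R : ℕ) {Q Q' : ℕ → ℝ} (hQ : ∀ k, 0 ≤ Q k) (hQ' : ∀ k, 0 ≤ Q' k) :
    uvSpaceMomentConst Λ R (uvPieceSq Λ Q Q') ≤
      1 / 4 * Real.sqrt (216 * (1 / Λ + 1 / 2)) * R *
        ∑ e : Fin 2 × Fin 2, (1 / (4 * (R : ℝ))) ^ ((e.1 : ℕ) + (e.2 : ℕ)) *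
          (uvLinV Λ (1 + (e.1 : ℕ) + (e.2 : ℕ)) * Q (1 + (e.1 : ℕ) + (e.2 : ℕ)) +
            uvLinD Λ (1 + (e.1 : ℕ) + (e.2 : ℕ)) * Q' (1 + (e.1 : ℕ) + (e.2 : ℕ))) := by
  unfold uvSpaceMomentConst
  have hR0 : (0 : ℝ) ≤ R := Nat.cast_nonneg R
  -- `√(216R²σ) = R·√(216σ)`
  have h1 : Real.sqrt (216 * (R : ℝ) ^ 2 * (1 / Λ + 1 / 2)) = (R : ℝ) * Real.sqrt (216 * (1 / Λ + 1 / 2)) := by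
    rw [show 216 * (R : ℝ) ^ 2 * (1 / Λ + 1 / 2) = (R : ℝ) ^ 2 * (216 * (1 / Λ + 1 / 2)) by ring,
      Real.sqrt_mul (sq_nonneg _), Real.sqrt_sq hR0]
  rw [h1]
  -- the square root of the `e`-sum is at most the sum of the square roots, term by term
  set X : Fin 2 × Fin 2 × Fin 2 → ℝ := fun e => ((Λ / 4) ^ 2) ^ (e.1 : ℕ) * ((1 / (4 * (R : ℝ))) ^ 2) ^ ((e.2.1 : ℕ) + (e.2.2 : ℕ)) *
    uvPieceSq Λ Q Q' (e.1 : ℕ) (1 + (e.2.1 : ℕ) + (e.2.2 : ℕ)) with hX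
  have hX0 : ∀ e, 0 ≤ X e := fun e => by
    have := uvPieceSq_nonneg hΛ Q Q' (e.1 : ℕ) (1 + (e.2.1 : ℕ) + (e.2.2 : ℕ)); positivity
  have hsq : Real.sqrt (∑ e : Fin 2 × Fin 2 × Fin 2, X e) ≤ ∑ e : Fin 2 × Fin 2 × Fin 2, Real.sqrt (X e) :=
    sqrt_sum_le_sum_sqrt _ _ fun e _ => hX0 e
  -- each square root
  have hterm : ∀ e' : Fin 2 × Fin 2,
      Real.sqrt (X (0, e')) + Real.sqrt (X (1, e')) ≤ (1 / (4 * (R : ℝ))) ^ ((e'.1 : ℕ) + (e'.2 : ℕ)) *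
        (uvLinV Λ (1 + (e'.1 : ℕ) + (e'.2 : ℕ)) * Q (1 + (e'.1 : ℕ) + (e'.2 : ℕ)) +
          uvLinD Λ (1 + (e'.1 : ℕ) + (e'.2 : ℕ)) * Q' (1 + (e'.1 : ℕ) + (e'.2 : ℕ))) := by
    intro e'
    set k := 1 + (e'.1 : ℕ) + (e'.2 : ℕ) with hk
    set ρ : ℝ := (1 / (4 * (R : ℝ))) ^ ((e'.1 : ℕ) + (e'.2 : ℕ)) with hρ
    have hρ0 : 0 ≤ ρ := by positivity
    -- `t = 0`
    have hs8 : Real.sqrt (8 / Λ) ^ 2 = 8 / Λ := Real.sq_sqrt (by positivity)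
    have e0 : X (0, e') = (ρ * ((2 * Real.pi) ^ k * Real.sqrt (8 / Λ) * Q k)) ^ 2 := by
      rw [show (ρ * ((2 * Real.pi) ^ k * Real.sqrt (8 / Λ) * Q k)) ^ 2 =
          ρ ^ 2 * ((2 * Real.pi) ^ k) ^ 2 * Real.sqrt (8 / Λ) ^ 2 * Q k ^ 2 by ring, hs8]
      simp only [hX, Fin.val_zero, pow_zero, one_mul, uvPieceSq, if_true, hρ, ← hk]
      simp only [← pow_mul]
      ring
    have h0 : Real.sqrt (X (0, e')) = ρ * ((2 * Real.pi) ^ k * Real.sqrt (8 / Λ) * Q k) := by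
      rw [e0, Real.sqrt_sq (by have := hQ k; positivity)]
    -- `t = 1`
    have e1 : X (1, e') = (Λ / 4 * ρ) ^ 2 * ((2 * Real.pi) ^ (2 * k + 2) * 16 * Q' k ^ 2 * (2 / Λ + 2 / Λ ^ 2) +
        2 * (2 * Real.pi) ^ (2 * k) * Q k ^ 2 / Real.pi ^ 2) := by
      simp only [hX, Fin.val_one, pow_one, uvPieceSq, one_ne_zero, if_false, hρ, ← hk]
      simp only [← pow_mul]
      ring
    have hA : Real.sqrt ((2 * Real.pi) ^ (2 * k + 2) * 16 * Q' k ^ 2 * (2 / Λ + 2 / Λ ^ 2)) =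
        (2 * Real.pi) ^ (k + 1) * 4 * Real.sqrt (2 / Λ + 2 / Λ ^ 2) * Q' k := by
      rw [show (2 * Real.pi) ^ (2 * k + 2) * 16 * Q' k ^ 2 * (2 / Λ + 2 / Λ ^ 2) =
          ((2 * Real.pi) ^ (k + 1) * 4 * Q' k) ^ 2 * (2 / Λ + 2 / Λ ^ 2) by ring,
        Real.sqrt_mul (sq_nonneg _), Real.sqrt_sq (by have := hQ' k; positivity)]
      ring
    have hB : Real.sqrt (2 * (2 * Real.pi) ^ (2 * k) * Q k ^ 2 / Real.pi ^ 2) = (2 * Real.pi) ^ k * (Real.sqrt 2 / Real.pi) * Q k := by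
      rw [show 2 * (2 * Real.pi) ^ (2 * k) * Q k ^ 2 / Real.pi ^ 2 = ((2 * Real.pi) ^ k * Q k / Real.pi) ^ 2 * 2 by
          field_simp; ring,
        Real.sqrt_mul (sq_nonneg _), Real.sqrt_sq (by have := hQ k; positivity)]
      ring
    have h1' : Real.sqrt (X (1, e')) ≤ Λ / 4 * ρ * ((2 * Real.pi) ^ (k + 1) * 4 * Real.sqrt (2 / Λ + 2 / Λ ^ 2) * Q' k +
        (2 * Real.pi) ^ k * (Real.sqrt 2 / Real.pi) * Q k) := by
      rw [e1, Real.sqrt_mul (sq_nonneg _), Real.sqrt_sq (by positivity), ← hA, ← hB]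
      refine mul_le_mul_of_nonneg_left ?_ (by positivity)
      have h := sqrt_sum_le_sum_sqrt (Finset.univ : Finset (Fin 2))
        (fun i => if i = 0 then (2 * Real.pi) ^ (2 * k + 2) * 16 * Q' k ^ 2 * (2 / Λ + 2 / Λ ^ 2)
          else 2 * (2 * Real.pi) ^ (2 * k) * Q k ^ 2 / Real.pi ^ 2)
        (fun i _ => by have := hQ k; have := hQ' k; split_ifs <;> positivity)
      simpa [Fin.sum_univ_two] using h
    rw [h0]
    refine (add_le_add le_rfl h1').trans (le_of_eq ?_)
    rw [uvLinV, uvLinD]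
    ring
  -- assemble
  have hsum : ∑ e : Fin 2 × Fin 2 × Fin 2, Real.sqrt (X e) =
      ∑ e' : Fin 2 × Fin 2, (Real.sqrt (X (0, e')) + Real.sqrt (X (1, e'))) := by
    rw [Fintype.sum_prod_type, Fin.sum_univ_two, ← sum_add_distrib]
  have hfin : Real.sqrt (∑ e : Fin 2 × Fin 2 × Fin 2, X e) ≤ ∑ e' : Fin 2 × Fin 2, (1 / (4 * (R : ℝ))) ^ ((e'.1 : ℕ) + (e'.2 : ℕ)) *
      (uvLinV Λ (1 + (e'.1 : ℕ) + (e'.2 : ℕ)) * Q (1 + (e'.1 : ℕ) + (e'.2 : ℕ)) +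
        uvLinD Λ (1 + (e'.1 : ℕ) + (e'.2 : ℕ)) * Q' (1 + (e'.1 : ℕ) + (e'.2 : ℕ))) := by
    refine hsq.trans ?_
    rw [hsum]
    exact sum_le_sum fun e' _ => hterm e'
  calc 1 / 4 * ((R : ℝ) * Real.sqrt (216 * (1 / Λ + 1 / 2))) * Real.sqrt (∑ e : Fin 2 × Fin 2 × Fin 2, X e)
      ≤ 1 / 4 * ((R : ℝ) * Real.sqrt (216 * (1 / Λ + 1 / 2))) * ∑ e' : Fin 2 × Fin 2, (1 / (4 * (R : ℝ))) ^ ((e'.1 : ℕ) + (e'.2 : ℕ)) *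
          (uvLinV Λ (1 + (e'.1 : ℕ) + (e'.2 : ℕ)) * Q (1 + (e'.1 : ℕ) + (e'.2 : ℕ)) +
            uvLinD Λ (1 + (e'.1 : ℕ) + (e'.2 : ℕ)) * Q' (1 + (e'.1 : ℕ) + (e'.2 : ℕ))) :=
        mul_le_mul_of_nonneg_left hfin (by positivity)
    _ = _ := by ring

end Literature.MathematicalPhysics.QuantumLattice

end
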